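import Summits.AtomisticToContinuum.BoseEinsteinCondensation.Theorems.BECConjugateDominationInfraredMinimumUncertaintyFSum
import Summits.AtomisticToContinuum.BoseEinsteinCondensation.Theorems.BECConjugateDominationInfraredMinimumUncertaintyFreeFisherGaussianity

/-!
# Route `BECConjugateDomination`, crux `InfraredMinimumUncertainty` (stmt-AtomisticToContinuum-11784),
# line `fisher-gaussian-density-mode`: the conjugate-proxy ladder (closed rungs and glue)

Supports (does not close) stmt-AtomisticToContinuum-11784. The kernel-checked bookkeeping of the gen-2
skeleton `Cruxes/InfraredMinimumUncertainty/Lines/fisher-gaussian-density-mode.lean`, made importable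
(objects and statements from `BECConjugateDominationDefs.lean`, f-sum identity from `…FSum.lean`):

* the exact data-processing rung `J_m(φ) ≤ 4m₂/(N²‖k‖⁴)` for every state, mode and continuous test
  field (`fisherTestV_le_secondMoment`, via the landed pointwise AM–GM `Theorems.BECConjugateDomination.pointwise_amgm`);
* the compositions: FD ∧ FG ⇒ IMU (`imu_of_fisher`, constants `C₁C₂/16`, `min ρ₁ ρ₂`), FD(C) ⇒ DMD(C),
  FS(C) ⇒ FG(4C), SMB ∧ SFC ⇒ FS, DMD ∧ FS ⇒ IMU, DMD ∧ SMB ∧ SFC ⇒ IMU — all concluding the crux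
  RESTATED over the named objects (`InfraredMinimumUncertaintyNamed`, `Iff.rfl`-equal to the route decl;
  the route decl itself is concluded by name only in the crux file, once the stubs close);
* the Cramér–Rao rung: `J(−λz) = 4λ − λ²·N S_m` (`fisherTestV_linear`, from the f-sum identity), hence the
  NECESSITY theorems IMU(C₀) ⇒ FD(4C₀+4) (`fisherDomination_of_imu`) and IMU ⇒ DMD
  (`densityMoment_of_imu`), unconditional: both registered/fallback phase-side stubs are genuine waypoints.

Proofs are the crux-plan gen-2 planner's (skeleton §Analytic, §Compositions, §Necessity), landed by the lead.
References: Stam, Inform. Control 2 (1959) 101 (Cramér–Rao / variational Fisher information); Stringari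
1995 §2.2 (9)–(11) (the reverse, `n₀`-carrying uncertainty inequality), §2.3 (Feynman/Puff sum rules).
-/

noncomputable section

open MeasureTheory Filter Set Metric
open scoped ENNReal NNReal Topology ComplexConjugate BigOperators

namespace Summit.AtomisticToContinuum.BoseEinsteinCondensation.Cruxes.InfraredMinimumUncertainty.FisherGaussianDensityMode

open Literature.MathematicalPhysics.QuantumManyBody.BoseGas
open Summit.AtomisticToContinuum.BoseEinsteinCondensation.Theses.BECConjugateDomination
  (InfraredMinimumUncertainty)
open Summit.AtomisticToContinuum.BoseEinsteinCondensation.Theorems.CorrectorClosure.Negative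
  (sideLength_succ_pos)
open Summit.AtomisticToContinuum.BoseEinsteinCondensation.Theorems.BECConjugateDomination (pointwise_amgm)

/-! ## The exact data-processing rung `J_m(φ) ≤ 4 m₂ / (N² ‖k‖⁴)` -/

section Analytic

/-- **`J_m(φ) ≤ 4m₂/(N²‖k‖⁴)` for every trial state, every mode and every continuous test field**
(the lifted Fisher information dominates its projection onto functions of the density mode; exact,
no Gram correction, no caustics). With FD this is FD(C) ⇒ DMD(C); with FS it is FS ⇒ FG. -/
theorem fisherTestV_le_secondMoment (n : ℕ) (L : ℝ) (Ψ : PeriodicTrialState (n + 1) L)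
    (m : Fin 3 → ℤ) {φ : ℂ → ℂ} (hφ : Continuous φ) :
    fisherTestV n L Ψ m φ ≤
      4 / (((n : ℝ) + 1) ^ 2 * ‖waveVec L m‖ ^ 4) * secondMoment (n + 1) L Ψ.ψ m := by
  set a : ℝ := 2 / (((n : ℝ) + 1) * ‖waveVec L m‖ ^ 2) with ha_def
  have ha : 0 ≤ a := by positivity
  have h4 : 4 / (((n : ℝ) + 1) * ‖waveVec L m‖ ^ 2) = 2 * a := by rw [ha_def]; ring
  have h4' : 4 / (((n : ℝ) + 1) ^ 2 * ‖waveVec L m‖ ^ 4) = a ^ 2 := by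
    rw [ha_def, div_pow]; ring
  have hZ := continuous_densityMode (n + 1) L m
  have hW := continuous_commutatorAmp (n + 1) L Ψ.contDiff m
  have hψ := Ψ.contDiff.continuous
  set f₁ : Config (n + 1) → ℝ := fun X =>
    (starRingEnd ℂ (φ (densityMode (n + 1) L m X)) * commutatorAmp (n + 1) L Ψ.ψ m X *
      starRingEnd ℂ (Ψ.ψ X)).re with hf₁
  set f₂ : Config (n + 1) → ℝ := fun X => ‖φ (densityMode (n + 1) L m X)‖ ^ 2 * ‖Ψ.ψ X‖ ^ 2 with hf₂
  set f₃ : Config (n + 1) → ℝ := fun X => ‖commutatorAmp (n + 1) L Ψ.ψ m X‖ ^ 2 with hf₃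
  have hc₁ : Continuous f₁ :=
    Complex.continuous_re.comp
      ((((Complex.continuous_conj.comp (hφ.comp hZ)).mul hW)).mul (Complex.continuous_conj.comp hψ))
  have hc₂ : Continuous f₂ := ((hφ.comp hZ).norm.pow 2).mul (hψ.norm.pow 2)
  have hc₃ : Continuous f₃ := hW.norm.pow 2
  have hi₁ : IntegrableOn f₁ (cellN (n + 1) L) volume := integrableOn_cellN hc₁ L
  have hi₂ : IntegrableOn f₂ (cellN (n + 1) L) volume := integrableOn_cellN hc₂ L
  have hi₃ : IntegrableOn f₃ (cellN (n + 1) L) volume := integrableOn_cellN hc₃ L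
  have hpt : ∀ X, -(2 * a) * f₁ X - f₂ X ≤ a ^ 2 * f₃ X := fun X => pointwise_amgm ha _ _ _
  have key : ∫ X in cellN (n + 1) L, (-(2 * a) * f₁ X - f₂ X) ≤ ∫ X in cellN (n + 1) L, a ^ 2 * f₃ X :=
    integral_mono ((hi₁.const_mul _).sub hi₂) (hi₃.const_mul _) hpt
  rw [integral_sub (hi₁.const_mul _) hi₂, integral_const_mul, integral_const_mul] at key
  unfold fisherTestV secondMoment
  rw [h4, h4']
  exact key

end Analytic

/-! ## Positivity helper -/

/-- `m₂ ≥ 0`. -/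
theorem secondMoment_nonneg (N : ℕ) (L : ℝ) (ψ : Config N → ℂ) (m : Fin 3 → ℤ) :
    0 ≤ secondMoment N L ψ m :=
  integral_nonneg fun X => by positivity

/-! ## Compositions (glue of the registered cut and of the fallback cuts) -/

section Compositions

/-- **FD ∧ FG ⇒ IMU, constants tracked**: `16 ν (N S) ≤ C₁ J(φ) (N S) ≤ C₁ C₂`, so the crux holds with
`C = C₁ C₂ / 16` and `ρ₀ = min ρ₁ ρ₂`. -/
theorem imu_of_fisher (hFD : FisherDominationV) (hFG : FisherGaussianityV) :
    InfraredMinimumUncertaintyNamed := by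
  intro v hv₁ hv₂ hv₃ hv₄
  obtain ⟨C₁, hC₁, ρ₁, hρ₁, h₁⟩ := hFD v hv₁ hv₂ hv₃ hv₄
  obtain ⟨C₂, hC₂, ρ₂, hρ₂, h₂⟩ := hFG v hv₁ hv₂ hv₃ hv₄
  refine ⟨C₁ * C₂ / 16, by positivity, min ρ₁ ρ₂, lt_min hρ₁ hρ₂, fun ρ hρ hρ₀ => ?_⟩
  filter_upwards [h₁ ρ hρ (lt_of_lt_of_le hρ₀ (min_le_left _ _)),
    h₂ ρ hρ (lt_of_lt_of_le hρ₀ (min_le_right _ _))] with n hn₁ hn₂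
  intro Ψ hE hfin hreal hpos m hm
  obtain ⟨φ, hφ, hFDm⟩ := hn₁ Ψ hE hfin hreal hpos m hm
  have hFGm := hn₂ Ψ hE hfin hreal hpos m hm φ hφ
  have hNS := mul_structureFactor_nonneg n (sideLength ρ (n + 1)) Ψ m
  have key : 16 * levyWeight n (sideLength ρ (n + 1)) Ψ m *
      (((n : ℝ) + 1) * structureFactor n (sideLength ρ (n + 1)) Ψ m) ≤ C₁ * C₂ :=
    calc 16 * levyWeight n (sideLength ρ (n + 1)) Ψ m *
          (((n : ℝ) + 1) * structureFactor n (sideLength ρ (n + 1)) Ψ m)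
        ≤ C₁ * fisherTestV n (sideLength ρ (n + 1)) Ψ m φ *
          (((n : ℝ) + 1) * structureFactor n (sideLength ρ (n + 1)) Ψ m) :=
          mul_le_mul_of_nonneg_right hFDm hNS
      _ = C₁ * (fisherTestV n (sideLength ρ (n + 1)) Ψ m φ *
          (((n : ℝ) + 1) * structureFactor n (sideLength ρ (n + 1)) Ψ m)) := by ring
      _ ≤ C₁ * C₂ := mul_le_mul_of_nonneg_left hFGm hC₁
  nlinarith [key]

/-- **FD(C) ⇒ DMD(C)** (the Fisher rung of the ladder, via `fisherTestV_le_secondMoment`):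
`16 ν ≤ C J(φ) ≤ 4C m₂/(N²‖k‖⁴)`. -/
theorem densityMoment_of_fisherDomination (hFD : FisherDominationV) : DensityMomentDomination := by
  intro v hv₁ hv₂ hv₃ hv₄
  obtain ⟨C₁, hC₁, ρ₁, hρ₁, h₁⟩ := hFD v hv₁ hv₂ hv₃ hv₄
  refine ⟨C₁, hC₁, ρ₁, hρ₁, fun ρ hρ hρ₀ => ?_⟩
  filter_upwards [h₁ ρ hρ hρ₀] with n hn₁
  intro Ψ hE hfin hreal hpos m hm
  obtain ⟨φ, hφ, hFDm⟩ := hn₁ Ψ hE hfin hreal hpos m hm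
  have hL := sideLength_succ_pos hρ n
  have hk := norm_waveVec_pos hL hm
  set P : ℝ := ((n : ℝ) + 1) ^ 2 * ‖waveVec (sideLength ρ (n + 1)) m‖ ^ 4 with hP_def
  have hP : 0 < P := by positivity
  have hJ := fisherTestV_le_secondMoment n (sideLength ρ (n + 1)) Ψ m hφ
  have hm₂ := secondMoment_nonneg (n + 1) (sideLength ρ (n + 1)) Ψ.ψ m
  -- 16 ν ≤ C₁ J ≤ C₁ (4/P) m₂
  have h2 : 16 * levyWeight n (sideLength ρ (n + 1)) Ψ m ≤ C₁ * (4 / P * secondMoment (n + 1) (sideLength ρ (n + 1)) Ψ.ψ m) :=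
    hFDm.trans (mul_le_mul_of_nonneg_left hJ hC₁)
  rw [show C₁ * (4 / P * secondMoment (n + 1) (sideLength ρ (n + 1)) Ψ.ψ m) =
      (4 * C₁ * secondMoment (n + 1) (sideLength ρ (n + 1)) Ψ.ψ m) / P by ring, le_div_iff₀ hP] at h2
  have hid : 4 * ((n : ℝ) + 1) ^ 2 * ‖waveVec (sideLength ρ (n + 1)) m‖ ^ 4 *
      levyWeight n (sideLength ρ (n + 1)) Ψ m = 4 * P * levyWeight n (sideLength ρ (n + 1)) Ψ m := by
    rw [hP_def]; ring
  rw [hid]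
  nlinarith [h2]

/-- **FS(C) ⇒ FG(4C)**: `J(φ)·(N S) ≤ (4m₂/(N²‖k‖⁴))·(N S) ≤ 4C`. -/
theorem fisherGaussianity_of_feynmanSaturation (hF : FeynmanSaturation) : FisherGaussianityV := by
  intro v hv₁ hv₂ hv₃ hv₄
  obtain ⟨C₁, hC₁, ρ₁, hρ₁, h₁⟩ := hF v hv₁ hv₂ hv₃ hv₄
  refine ⟨4 * C₁, by positivity, ρ₁, hρ₁, fun ρ hρ hρ₀ => ?_⟩
  filter_upwards [h₁ ρ hρ hρ₀] with n hn₁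
  intro Ψ hE hfin hreal hpos m hm φ hφ
  have hFm := hn₁ Ψ hE hfin hreal hpos m hm
  have hL := sideLength_succ_pos hρ n
  have hk := norm_waveVec_pos hL hm
  set P : ℝ := ((n : ℝ) + 1) ^ 2 * ‖waveVec (sideLength ρ (n + 1)) m‖ ^ 4 with hP_def
  have hP : 0 < P := by positivity
  have hJ := fisherTestV_le_secondMoment n (sideLength ρ (n + 1)) Ψ m hφ
  have hNS := mul_structureFactor_nonneg n (sideLength ρ (n + 1)) Ψ m
  have hm₂ := secondMoment_nonneg (n + 1) (sideLength ρ (n + 1)) Ψ.ψ m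
  calc fisherTestV n (sideLength ρ (n + 1)) Ψ m φ *
        (((n : ℝ) + 1) * structureFactor n (sideLength ρ (n + 1)) Ψ m)
      ≤ (4 / P * secondMoment (n + 1) (sideLength ρ (n + 1)) Ψ.ψ m) *
        (((n : ℝ) + 1) * structureFactor n (sideLength ρ (n + 1)) Ψ m) :=
        mul_le_mul_of_nonneg_right hJ hNS
    _ = 4 / P * ((((n : ℝ) + 1) * structureFactor n (sideLength ρ (n + 1)) Ψ m) *
        secondMoment (n + 1) (sideLength ρ (n + 1)) Ψ.ψ m) := by ring
    _ ≤ 4 / P * (C₁ * P) := mul_le_mul_of_nonneg_left hFm (by positivity)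
    _ = 4 * C₁ := by field_simp

/-- **SMB(C₁) ∧ SFC(C₂) ⇒ FS(C₁C₂)**: `(N S) m₂ ≤ (N C₂‖k‖/√(‖k‖²+ρ)) (C₁ N ‖k‖³ √(‖k‖²+ρ)) = C₁C₂ N²‖k‖⁴`. -/
theorem feynmanSaturation_of_moments (hM : SecondMomentBound) (hS : StructureFactorCeiling) :
    FeynmanSaturation := by
  intro v hv₁ hv₂ hv₃ hv₄
  obtain ⟨C₁, hC₁, ρ₁, hρ₁, h₁⟩ := hM v hv₁ hv₂ hv₃ hv₄
  obtain ⟨C₂, hC₂, ρ₂, hρ₂, h₂⟩ := hS v hv₁ hv₂ hv₃ hv₄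
  refine ⟨C₁ * C₂, by positivity, min ρ₁ ρ₂, lt_min hρ₁ hρ₂, fun ρ hρ hρ₀ => ?_⟩
  filter_upwards [h₁ ρ hρ (lt_of_lt_of_le hρ₀ (min_le_left _ _)),
    h₂ ρ hρ (lt_of_lt_of_le hρ₀ (min_le_right _ _))] with n hn₁ hn₂
  intro Ψ hE hfin hreal hpos m hm
  have hMm := hn₁ Ψ hE hfin hreal hpos m hm
  have hSm := hn₂ Ψ hE hfin hreal hpos m hm
  have hL := sideLength_succ_pos hρ n
  have hk := norm_waveVec_pos hL hm
  set κ : ℝ := ‖waveVec (sideLength ρ (n + 1)) m‖ with hκ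
  set N : ℝ := (n : ℝ) + 1 with hN
  have hNpos : 0 < N := by positivity
  have hs : 0 < Real.sqrt (κ ^ 2 + ρ) := Real.sqrt_pos.mpr (by positivity)
  have hm₂ := secondMoment_nonneg (n + 1) (sideLength ρ (n + 1)) Ψ.ψ m
  have hNS : N * structureFactor n (sideLength ρ (n + 1)) Ψ m ≤ N * (C₂ * κ / Real.sqrt (κ ^ 2 + ρ)) :=
    mul_le_mul_of_nonneg_left hSm hNpos.le
  have hNS0 := mul_structureFactor_nonneg n (sideLength ρ (n + 1)) Ψ m
  calc N * structureFactor n (sideLength ρ (n + 1)) Ψ m * secondMoment (n + 1) (sideLength ρ (n + 1)) Ψ.ψ m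
      ≤ (N * (C₂ * κ / Real.sqrt (κ ^ 2 + ρ))) * (C₁ * N * κ ^ 3 * Real.sqrt (κ ^ 2 + ρ)) :=
        mul_le_mul hNS hMm hm₂ (by positivity)
    _ = C₁ * C₂ * (N ^ 2 * κ ^ 4) := by
        field_simp

/-- **DMD(C₁) ∧ FS(C₂) ⇒ IMU(C₁C₂/4)** (the moment cut of the ladder):
`4N²‖k‖⁴ ν (N S) ≤ C₁ m₂ (N S) ≤ C₁ C₂ N²‖k‖⁴`. -/
theorem imu_of_densityMoment (hD : DensityMomentDomination) (hF : FeynmanSaturation) :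
    InfraredMinimumUncertaintyNamed := by
  intro v hv₁ hv₂ hv₃ hv₄
  obtain ⟨C₁, hC₁, ρ₁, hρ₁, h₁⟩ := hD v hv₁ hv₂ hv₃ hv₄
  obtain ⟨C₂, hC₂, ρ₂, hρ₂, h₂⟩ := hF v hv₁ hv₂ hv₃ hv₄
  refine ⟨C₁ * C₂ / 4, by positivity, min ρ₁ ρ₂, lt_min hρ₁ hρ₂, fun ρ hρ hρ₀ => ?_⟩
  filter_upwards [h₁ ρ hρ (lt_of_lt_of_le hρ₀ (min_le_left _ _)),
    h₂ ρ hρ (lt_of_lt_of_le hρ₀ (min_le_right _ _))] with n hn₁ hn₂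
  intro Ψ hE hfin hreal hpos m hm
  have hDm := hn₁ Ψ hE hfin hreal hpos m hm
  have hFm := hn₂ Ψ hE hfin hreal hpos m hm
  have hL := sideLength_succ_pos hρ n
  have hk := norm_waveVec_pos hL hm
  set P : ℝ := ((n : ℝ) + 1) ^ 2 * ‖waveVec (sideLength ρ (n + 1)) m‖ ^ 4 with hP_def
  have hP : 0 < P := by positivity
  have hNS := mul_structureFactor_nonneg n (sideLength ρ (n + 1)) Ψ m
  have hm₂ := secondMoment_nonneg (n + 1) (sideLength ρ (n + 1)) Ψ.ψ m
  -- 4 P ν ≤ C₁ m₂  ⇒  4 P ν (N S) ≤ C₁ m₂ (N S) ≤ C₁ C₂ P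
  have h3 : 4 * P * levyWeight n (sideLength ρ (n + 1)) Ψ m *
      (((n : ℝ) + 1) * structureFactor n (sideLength ρ (n + 1)) Ψ m) ≤ C₁ * C₂ * P := by
    calc 4 * P * levyWeight n (sideLength ρ (n + 1)) Ψ m *
          (((n : ℝ) + 1) * structureFactor n (sideLength ρ (n + 1)) Ψ m)
        ≤ C₁ * secondMoment (n + 1) (sideLength ρ (n + 1)) Ψ.ψ m *
          (((n : ℝ) + 1) * structureFactor n (sideLength ρ (n + 1)) Ψ m) := by
          have : 4 * P * levyWeight n (sideLength ρ (n + 1)) Ψ m =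
              4 * ((n : ℝ) + 1) ^ 2 * ‖waveVec (sideLength ρ (n + 1)) m‖ ^ 4 *
                levyWeight n (sideLength ρ (n + 1)) Ψ m := by rw [hP_def]; ring
          rw [this]
          exact mul_le_mul_of_nonneg_right hDm hNS
      _ = C₁ * ((((n : ℝ) + 1) * structureFactor n (sideLength ρ (n + 1)) Ψ m) *
          secondMoment (n + 1) (sideLength ρ (n + 1)) Ψ.ψ m) := by ring
      _ ≤ C₁ * (C₂ * P) := mul_le_mul_of_nonneg_left hFm hC₁
      _ = C₁ * C₂ * P := by ring
  have h4 : 4 * P * (((n : ℝ) + 1) * levyWeight n (sideLength ρ (n + 1)) Ψ m *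
      structureFactor n (sideLength ρ (n + 1)) Ψ m) ≤ 4 * P * (C₁ * C₂ / 4) := by
    have : 4 * P * (((n : ℝ) + 1) * levyWeight n (sideLength ρ (n + 1)) Ψ m *
        structureFactor n (sideLength ρ (n + 1)) Ψ m) =
        4 * P * levyWeight n (sideLength ρ (n + 1)) Ψ m *
          (((n : ℝ) + 1) * structureFactor n (sideLength ρ (n + 1)) Ψ m) := by ring
    rw [this]
    linarith [h3]
  exact le_of_mul_le_mul_left h4 (by positivity)

/-- SMB ∧ SFC ⇒ FG (the density-side residual of the registered cut follows from the moment bounds). -/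
theorem fisherGaussianity_of_moments (hM : SecondMomentBound) (hS : StructureFactorCeiling) :
    FisherGaussianityV :=
  fisherGaussianity_of_feynmanSaturation (feynmanSaturation_of_moments hM hS)

/-- DMD ∧ SMB ∧ SFC ⇒ IMU (the three-stub moment cut). -/
theorem imu_of_moments (hD : DensityMomentDomination) (hM : SecondMomentBound)
    (hS : StructureFactorCeiling) : InfraredMinimumUncertaintyNamed :=
  imu_of_densityMoment hD (feynmanSaturation_of_moments hM hS)

/-- FD ∧ FS ⇒ IMU and FD ∧ SMB ∧ SFC ⇒ IMU (dominated cuts, recorded for completeness). -/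
theorem imu_of_fisherDomination_of_feynmanSaturation (hFD : FisherDominationV)
    (hF : FeynmanSaturation) : InfraredMinimumUncertaintyNamed :=
  imu_of_fisher hFD (fisherGaussianity_of_feynmanSaturation hF)

end Compositions

/-! ## The Cramér–Rao rung and the necessity of the phase-side waypoints -/

section Necessity

/-- **The Cramér–Rao computation**: `J(φ_λ) = 4λ − λ² · N S_m` for the linear field `φ_λ(z) = −λz`. -/
theorem fisherTestV_linear {n : ℕ} {L : ℝ} (hL : 0 < L)
    (Ψ : PeriodicTrialState (n + 1) L) (hreal : ∀ X, Ψ.ψ X = (‖Ψ.ψ X‖ : ℂ))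
    {m : Fin 3 → ℤ} (hm : m ≠ 0) (lam : ℝ) :
    fisherTestV n L Ψ m (fun z => -(lam : ℂ) * z) =
      4 * lam - lam ^ 2 * ∫ X in cellN (n + 1) L, ‖densityMode (n + 1) L m X‖ ^ 2 * ‖Ψ.ψ X‖ ^ 2 := by
  have hk := norm_waveVec_pos hL hm
  have hN : (0 : ℝ) < (n : ℝ) + 1 := by positivity
  have h1 : ∀ X : Config (n + 1),
      (starRingEnd ℂ (-(lam : ℂ) * densityMode (n + 1) L m X) * commutatorAmp (n + 1) L Ψ.ψ m X *
        starRingEnd ℂ (Ψ.ψ X)).re =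
      -lam * (starRingEnd ℂ (densityMode (n + 1) L m X) * commutatorAmp (n + 1) L Ψ.ψ m X *
        starRingEnd ℂ (Ψ.ψ X)).re := by
    intro X
    rw [map_mul, map_neg, Complex.conj_ofReal]
    simp only [neg_mul, mul_assoc, Complex.neg_re, Complex.re_ofReal_mul]
  have h2 : ∀ X : Config (n + 1),
      ‖-(lam : ℂ) * densityMode (n + 1) L m X‖ ^ 2 * ‖Ψ.ψ X‖ ^ 2 =
        lam ^ 2 * (‖densityMode (n + 1) L m X‖ ^ 2 * ‖Ψ.ψ X‖ ^ 2) := by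
    intro X
    rw [norm_mul, norm_neg, Complex.norm_real, Real.norm_eq_abs, mul_pow, sq_abs]
    ring
  unfold fisherTestV
  simp_rw [h1, h2]
  rw [integral_const_mul, integral_const_mul, fSumIdentity_holds n L hL Ψ hreal m]
  field_simp

/-- **IMU ⇒ FD** with `C = 4C₀ + 4`, the witness being the linear field at `λ = 2/(N S_m)`
(or `λ = |ν_m|` in the degenerate case `N S_m = 0`). Unconditional. -/
theorem fisherDomination_of_imu : InfraredMinimumUncertainty → FisherDominationV := by
  intro h v hv₁ hv₂ hv₃ hv₄
  obtain ⟨C₀, hC₀, ρ₀, hρ₀, h₀⟩ := h v hv₁ hv₂ hv₃ hv₄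
  refine ⟨4 * C₀ + 4, by positivity, ρ₀, hρ₀, fun ρ hρ hρ' => ?_⟩
  filter_upwards [h₀ ρ hρ hρ'] with n hn
  intro Ψ hE hfin hreal hpos m hm
  have hL := sideLength_succ_pos hρ n
  have himu : ((n : ℝ) + 1) * levyWeight n (sideLength ρ (n + 1)) Ψ m *
      structureFactor n (sideLength ρ (n + 1)) Ψ m ≤ C₀ := hn Ψ hE hfin hreal hpos m hm
  have hA0 : 0 ≤ ∫ X in cellN (n + 1) (sideLength ρ (n + 1)),
      ‖densityMode (n + 1) (sideLength ρ (n + 1)) m X‖ ^ 2 * ‖Ψ.ψ X‖ ^ 2 :=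
    integral_nonneg fun X => by positivity
  have hNS : ((n : ℝ) + 1) * structureFactor n (sideLength ρ (n + 1)) Ψ m =
      ∫ X in cellN (n + 1) (sideLength ρ (n + 1)),
        ‖densityMode (n + 1) (sideLength ρ (n + 1)) m X‖ ^ 2 * ‖Ψ.ψ X‖ ^ 2 := by
    unfold structureFactor densityMode
    rw [← mul_assoc, mul_inv_cancel₀ (by positivity), one_mul]
  have hνA : levyWeight n (sideLength ρ (n + 1)) Ψ m *
      (∫ X in cellN (n + 1) (sideLength ρ (n + 1)),
        ‖densityMode (n + 1) (sideLength ρ (n + 1)) m X‖ ^ 2 * ‖Ψ.ψ X‖ ^ 2) ≤ C₀ := by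
    rw [← hNS]
    have : ((n : ℝ) + 1) * levyWeight n (sideLength ρ (n + 1)) Ψ m *
        structureFactor n (sideLength ρ (n + 1)) Ψ m =
        levyWeight n (sideLength ρ (n + 1)) Ψ m *
          (((n : ℝ) + 1) * structureFactor n (sideLength ρ (n + 1)) Ψ m) := by ring
    rw [this] at himu
    exact himu
  have hJ : ∀ lam : ℝ, fisherTestV n (sideLength ρ (n + 1)) Ψ m (fun z => -(lam : ℂ) * z) =
      4 * lam - lam ^ 2 * ∫ X in cellN (n + 1) (sideLength ρ (n + 1)),
        ‖densityMode (n + 1) (sideLength ρ (n + 1)) m X‖ ^ 2 * ‖Ψ.ψ X‖ ^ 2 :=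
    fun lam => fisherTestV_linear hL Ψ hreal hm lam
  have hcont : ∀ lam : ℝ, Continuous (fun z : ℂ => -(lam : ℂ) * z) := fun lam =>
    continuous_const.mul continuous_id
  generalize hA : (∫ X in cellN (n + 1) (sideLength ρ (n + 1)),
      ‖densityMode (n + 1) (sideLength ρ (n + 1)) m X‖ ^ 2 * ‖Ψ.ψ X‖ ^ 2) = A at hA0 hνA hJ
  generalize hν : levyWeight n (sideLength ρ (n + 1)) Ψ m = ν at hνA ⊢
  by_cases hApos : 0 < A
  · refine ⟨fun z => -((2 / A : ℝ) : ℂ) * z, hcont _, ?_⟩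
    rw [hJ, show 4 * (2 / A) - (2 / A) ^ 2 * A = 4 / A by field_simp; ring,
      show (4 * C₀ + 4) * (4 / A) = (16 * (C₀ + 1)) / A by ring, le_div_iff₀ hApos]
    have : 16 * ν * A = 16 * (ν * A) := by ring
    rw [this]
    linarith
  · have hA_eq : A = 0 := le_antisymm (not_lt.mp hApos) hA0
    refine ⟨fun z => -((|ν| : ℝ) : ℂ) * z, hcont _, ?_⟩
    rw [hJ, hA_eq]
    simp only [mul_zero, sub_zero]
    nlinarith [le_abs_self ν, abs_nonneg ν, mul_nonneg hC₀ (abs_nonneg ν)]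

/-- **IMU ⇒ DMD** (the sibling card's waypoint is necessary too). Unconditional. -/
theorem densityMoment_of_imu (h : InfraredMinimumUncertainty) : DensityMomentDomination :=
  densityMoment_of_fisherDomination (fisherDomination_of_imu h)

end Necessity

end Summit.AtomisticToContinuum.BoseEinsteinCondensation.Cruxes.InfraredMinimumUncertainty.FisherGaussianDensityMode

end
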